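import Mathlib
import Summits.Ventures.PercRepro.PuncturedLYMMixP1Q2Table1

/-!
# PercRepro — (SP) FOR `1` PAIRWISE DISJOINT PAIRS AND `2` PAIRWISE DISJOINT QUADRUPLES AT LEVEL `4`: POSITIVITY OF THE DENOMINATORS (1)
(p10, gen 41)

`den > 0`, `Pc > 0` for `n ≥ 10`; `Yc > 0` for `n ≥ 5`.  Nothing here asserts (SP).
-/

namespace PercRepro.PuncturedLYM.Split.TypeLift.MixP1Q2

/-- `den > 0` for `n ≥ 10`. -/
theorem den_pos (n : ℚ) (hn : 10 ≤ n) : 0 < den n := by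
  obtain ⟨n', hn', rfl⟩ : ∃ n', 0 ≤ n' ∧ n = 10 + n' := ⟨n - 10, by linarith, by ring⟩
  have h : den (10 + n') = 13824 * n' ^ 11 + 1310976 * n' ^ 10 + 56171040 * n' ^ 9 + 1435434384 * n' ^ 8 + 24308902032 * n' ^ 7 + 286434271680 * n' ^ 6 + 2396013458496 * n' ^ 5 + 14226119219472 * n' ^ 4 + 58741611389712 * n' ^ 3 + 160604177018016 * n' ^ 2 + 261587916458496 * n' + 192216608686080 := by unfold den; ring
  rw [h]; positivity

/-- `Yc > 0` for `n ≥ 5`. -/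
theorem Yc_pos (n : ℚ) (hn : 5 ≤ n) : 0 < Yc n := by
  obtain ⟨n', hn', rfl⟩ : ∃ n', 0 ≤ n' ∧ n = 5 + n' := ⟨n - 5, by linarith, by ring⟩
  have h : Yc (5 + n') = (1 / 120) * n' ^ 5 + (1 / 8) * n' ^ 4 + (17 / 24) * n' ^ 3 + (15 / 8) * n' ^ 2 + (137 / 60) * n' + 1 := by unfold Yc; ring
  rw [h]; positivity

/-- `Pc > 0` for `n ≥ 10`. -/
theorem Pc_pos (n : ℚ) (hn : 10 ≤ n) : 0 < Pc n := by
  obtain ⟨n', hn', rfl⟩ : ∃ n', 0 ≤ n' ∧ n = 10 + n' := ⟨n - 10, by linarith, by ring⟩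
  have h : Pc (10 + n') = (1 / 24) * n' ^ 4 + (17 / 12) * n' ^ 3 + (419 / 24) * n' ^ 2 + (1117 / 12) * n' + 180 := by unfold Pc; ring
  rw [h]; positivity

end PercRepro.PuncturedLYM.Split.TypeLift.MixP1Q2
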